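import Mathlib
import HarnessLib
import Summits.AtomisticToContinuum.Crystallization.Theorems.PricedLinkCensusSoftLayerPropagationStubBallPropagationPairs
import Summits.AtomisticToContinuum.Crystallization.Theorems.PricedLinkCensusSoftLayerPropagationStubBallPropagationDisc

/-!
# Local layer-propagation lemmas for the finite-ball form of Hales, *Dense Sphere Packings* §1.3 (VI):
# the HCP disc and the FCC disc

Route `PricedLinkCensus`, crux `SoftLayerPropagation` (stmt-AtomisticToContinuum-14233), line
`Sketch`, sixth helper file for the stub `stub_ballPropagation` (frame `u₁ = triangularVec₁ 2`,
`u₂ = triangularVec₂ 2` of `LayerShells.lean`): the disc induction of `…StubBallPropagationDisc.lean`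
run with the in-layer steps of `…StubBallPropagationPairs.lean`.

* `hcp_disc` — if every lattice-point CENTRE `p` of the disc `‖p − c‖ ≤ R` of the layer through
  the origin has a pattern shell and the lattice point `p₀` (`‖p₀ − c‖² ≤ 2`) is a centre with
  shell `layerShell s s`, then every lattice point of the disc is a centre with shell `layerShell s s`
  ("as soon as some center has the HCP pattern, the pattern propagates along the plane of
  symmetry" — on a disc, which is what a finite-ball hypothesis allows);
* `fcc_disc` — if every lattice-point centre of the disc has an FCC shell and the hexagon of `p₀`
  is occupied, every lattice point of the disc is a centre with occupied hexagon ("adjacent FCC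
  patterns interlock", on a disc).

Both cite DSP §1.3 as the tree lemmas (`layer_subset_of_hcp`, `layer_subset_of_fcc`) they localise.
-/

noncomputable section

namespace Summit.AtomisticToContinuum.Crystallization.Theorems

open Literature.Geometry.DiscreteGeometry Literature.MathematicalPhysics.StatisticalMechanics
open RealInnerProductSpace

section Disc

variable {V : Set (EuclideanSpace ℝ (Fin 3))}

/-- **HCP disc** ("as soon as some center has the HCP pattern, the pattern propagates along the
plane of symmetry", on a disc): if every lattice-point centre `p` of the disc `‖p − c‖ ≤ R` has a
pattern shell and the lattice point `p₀` (`‖p₀ − c‖² ≤ 2`) is a centre with shell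
`layerShell s s`, then every lattice point of the disc is a centre with shell `layerShell s s`.
[cite: HalesDSP2012, §1.3] -/
theorem hcp_disc (hV : IsUnitBallPacking V) {s : ℝ} (hs : s = 1 ∨ s = -1)
    {c : EuclideanSpace ℝ (Fin 3)} (hc : c 2 = 0) {R : ℝ}
    (hpat : ∀ i j : ℤ,
      ‖((i : ℝ) • (triangularVec₁ 2 : EuclideanSpace ℝ (Fin 3)) + (j : ℝ) • triangularVec₂ 2) - c‖ ≤ R →
      (i : ℝ) • (triangularVec₁ 2 : EuclideanSpace ℝ (Fin 3)) + (j : ℝ) • triangularVec₂ 2 ∈ V →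
      IsArrangedIn (kissingShell V ((i : ℝ) • (triangularVec₁ 2 : EuclideanSpace ℝ (Fin 3)) +
          (j : ℝ) • triangularVec₂ 2)) fccKissingPattern ∨
        IsArrangedIn (kissingShell V ((i : ℝ) • (triangularVec₁ 2 : EuclideanSpace ℝ (Fin 3)) +
          (j : ℝ) • triangularVec₂ 2)) hcpKissingPattern)
    {i₀ j₀ : ℤ}
    (h₀c : ‖((i₀ : ℝ) • (triangularVec₁ 2 : EuclideanSpace ℝ (Fin 3)) + (j₀ : ℝ) • triangularVec₂ 2) - c‖ ^ 2
      ≤ 2)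
    (h₀V : (i₀ : ℝ) • (triangularVec₁ 2 : EuclideanSpace ℝ (Fin 3)) + (j₀ : ℝ) • triangularVec₂ 2 ∈ V)
    (h₀ : kissingShell V ((i₀ : ℝ) • (triangularVec₁ 2 : EuclideanSpace ℝ (Fin 3)) +
      (j₀ : ℝ) • triangularVec₂ 2) = layerShell s s) :
    ∀ i j : ℤ,
      ‖((i : ℝ) • (triangularVec₁ 2 : EuclideanSpace ℝ (Fin 3)) + (j : ℝ) • triangularVec₂ 2) - c‖ ≤ R →
      (i : ℝ) • (triangularVec₁ 2 : EuclideanSpace ℝ (Fin 3)) + (j : ℝ) • triangularVec₂ 2 ∈ V ∧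
        kissingShell V ((i : ℝ) • (triangularVec₁ 2 : EuclideanSpace ℝ (Fin 3)) +
          (j : ℝ) • triangularVec₂ 2) = layerShell s s := by
  refine lattice_disc_induction hc (Q := fun i j =>
    (i : ℝ) • (triangularVec₁ 2 : EuclideanSpace ℝ (Fin 3)) + (j : ℝ) • triangularVec₂ 2 ∈ V ∧
      kissingShell V ((i : ℝ) • (triangularVec₁ 2 : EuclideanSpace ℝ (Fin 3)) +
        (j : ℝ) • triangularVec₂ 2) = layerShell s s) ?_ h₀c ⟨h₀V, h₀⟩
  rintro i j ⟨hV', hS⟩ η hη i' j' he hR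
  have hmem : (i : ℝ) • (triangularVec₁ 2 : EuclideanSpace ℝ (Fin 3)) + (j : ℝ) • triangularVec₂ 2 + η ∈ V := by
    have : η ∈ kissingShell V ((i : ℝ) • (triangularVec₁ 2 : EuclideanSpace ℝ (Fin 3)) +
        (j : ℝ) • triangularVec₂ 2) := by
      rw [hS]; exact hexagonSet_subset_layerShell _ _ hη
    exact this.1
  have hpat' := hpat i' j' hR (by rw [he]; exact hmem)
  rw [he] at hpat' ⊢
  exact kissingShell_add_eq_layerShell_of_hcp_dir hV hs hV' hS hη hpat'

/-- **FCC disc** ("adjacent FCC patterns interlock", on a disc): if every lattice-point centre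
`p` of the disc `‖p − c‖ ≤ R` has an FCC shell and the lattice point `p₀` (`‖p₀ − c‖² ≤ 2`) is
a centre whose hexagon is occupied, then every lattice point of the disc is a centre whose hexagon
is occupied (its shell contains the standard hexagon). [cite: HalesDSP2012, §1.3] -/
theorem fcc_disc {c : EuclideanSpace ℝ (Fin 3)} (hc : c 2 = 0) {R : ℝ}
    (hfcc : ∀ i j : ℤ,
      ‖((i : ℝ) • (triangularVec₁ 2 : EuclideanSpace ℝ (Fin 3)) + (j : ℝ) • triangularVec₂ 2) - c‖ ≤ R →
      (i : ℝ) • (triangularVec₁ 2 : EuclideanSpace ℝ (Fin 3)) + (j : ℝ) • triangularVec₂ 2 ∈ V →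
      IsArrangedIn (kissingShell V ((i : ℝ) • (triangularVec₁ 2 : EuclideanSpace ℝ (Fin 3)) +
          (j : ℝ) • triangularVec₂ 2)) fccKissingPattern)
    {i₀ j₀ : ℤ}
    (h₀c : ‖((i₀ : ℝ) • (triangularVec₁ 2 : EuclideanSpace ℝ (Fin 3)) + (j₀ : ℝ) • triangularVec₂ 2) - c‖ ^ 2
      ≤ 2)
    (h₀V : (i₀ : ℝ) • (triangularVec₁ 2 : EuclideanSpace ℝ (Fin 3)) + (j₀ : ℝ) • triangularVec₂ 2 ∈ V)
    (h₀ : hexagonSet ⊆ kissingShell V ((i₀ : ℝ) • (triangularVec₁ 2 : EuclideanSpace ℝ (Fin 3)) +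
      (j₀ : ℝ) • triangularVec₂ 2)) :
    ∀ i j : ℤ,
      ‖((i : ℝ) • (triangularVec₁ 2 : EuclideanSpace ℝ (Fin 3)) + (j : ℝ) • triangularVec₂ 2) - c‖ ≤ R →
      (i : ℝ) • (triangularVec₁ 2 : EuclideanSpace ℝ (Fin 3)) + (j : ℝ) • triangularVec₂ 2 ∈ V ∧
        hexagonSet ⊆ kissingShell V ((i : ℝ) • (triangularVec₁ 2 : EuclideanSpace ℝ (Fin 3)) +
          (j : ℝ) • triangularVec₂ 2) := by
  refine lattice_disc_induction hc (Q := fun i j =>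
    (i : ℝ) • (triangularVec₁ 2 : EuclideanSpace ℝ (Fin 3)) + (j : ℝ) • triangularVec₂ 2 ∈ V ∧
      hexagonSet ⊆ kissingShell V ((i : ℝ) • (triangularVec₁ 2 : EuclideanSpace ℝ (Fin 3)) +
        (j : ℝ) • triangularVec₂ 2)) ?_ h₀c ⟨h₀V, h₀⟩
  rintro i j ⟨hV', hS⟩ η hη i' j' he hR
  have hH : ∀ x ∈ hexagonSet,
      (i : ℝ) • (triangularVec₁ 2 : EuclideanSpace ℝ (Fin 3)) + (j : ℝ) • triangularVec₂ 2 + x ∈ V :=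
    fun x hx => (hS hx).1
  have hmem := hH η hη
  have hfcc' := hfcc i' j' hR (by rw [he]; exact hmem)
  rw [he] at hfcc' ⊢
  exact ⟨hmem, hexagonSet_subset_kissingShell_add_of_fcc_dir hV' hH hη hfcc'⟩

end Disc

/-- **Registered sub-goal `ballPropagation_hcpDisc`** of the crux item (the HCP disc, in closed
form): `hcp_disc`. [folklore] -/
theorem ballPropagation_hcpDisc :
    ∀ (V : Set (EuclideanSpace ℝ (Fin 3))), Literature.Geometry.DiscreteGeometry.IsUnitBallPacking
    V → ∀ (s : ℝ), (s = 1 ∨ s = -1) → ∀ (c : EuclideanSpace ℝ (Fin 3)), c 2 = 0 → ∀ (R : ℝ), (∀ i j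
    : ℤ, ‖((i : ℝ) • (Literature.MathematicalPhysics.StatisticalMechanics.triangularVec₁ 2 :
    EuclideanSpace ℝ (Fin 3)) + (j : ℝ) •
    Literature.MathematicalPhysics.StatisticalMechanics.triangularVec₂ 2) - c‖ ≤ R → (i : ℝ) •
    (Literature.MathematicalPhysics.StatisticalMechanics.triangularVec₁ 2 : EuclideanSpace ℝ (Fin
    3)) + (j : ℝ) • Literature.MathematicalPhysics.StatisticalMechanics.triangularVec₂ 2 ∈ V →
    Literature.Geometry.DiscreteGeometry.IsArrangedIn
    (Literature.Geometry.DiscreteGeometry.kissingShell V ((i : ℝ) •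
    (Literature.MathematicalPhysics.StatisticalMechanics.triangularVec₁ 2 : EuclideanSpace ℝ (Fin
    3)) + (j : ℝ) • Literature.MathematicalPhysics.StatisticalMechanics.triangularVec₂ 2))
    Literature.Geometry.DiscreteGeometry.fccKissingPattern ∨
    Literature.Geometry.DiscreteGeometry.IsArrangedIn
    (Literature.Geometry.DiscreteGeometry.kissingShell V ((i : ℝ) •
    (Literature.MathematicalPhysics.StatisticalMechanics.triangularVec₁ 2 : EuclideanSpace ℝ (Fin
    3)) + (j : ℝ) • Literature.MathematicalPhysics.StatisticalMechanics.triangularVec₂ 2))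
    Literature.Geometry.DiscreteGeometry.hcpKissingPattern) → ∀ (i₀ j₀ : ℤ), ‖((i₀ : ℝ) •
    (Literature.MathematicalPhysics.StatisticalMechanics.triangularVec₁ 2 : EuclideanSpace ℝ (Fin
    3)) + (j₀ : ℝ) • Literature.MathematicalPhysics.StatisticalMechanics.triangularVec₂ 2) - c‖ ^ 2
    ≤ 4 / 3 → (i₀ : ℝ) • (Literature.MathematicalPhysics.StatisticalMechanics.triangularVec₁ 2 :
    EuclideanSpace ℝ (Fin 3)) + (j₀ : ℝ) •
    Literature.MathematicalPhysics.StatisticalMechanics.triangularVec₂ 2 ∈ V →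
    Literature.Geometry.DiscreteGeometry.kissingShell V ((i₀ : ℝ) •
    (Literature.MathematicalPhysics.StatisticalMechanics.triangularVec₁ 2 : EuclideanSpace ℝ (Fin
    3)) + (j₀ : ℝ) • Literature.MathematicalPhysics.StatisticalMechanics.triangularVec₂ 2) =
    Literature.Geometry.DiscreteGeometry.layerShell s s → ∀ i j : ℤ, ‖((i : ℝ) •
    (Literature.MathematicalPhysics.StatisticalMechanics.triangularVec₁ 2 : EuclideanSpace ℝ (Fin
    3)) + (j : ℝ) • Literature.MathematicalPhysics.StatisticalMechanics.triangularVec₂ 2) - c‖ ≤ R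
    → (i : ℝ) • (Literature.MathematicalPhysics.StatisticalMechanics.triangularVec₁ 2 :
    EuclideanSpace ℝ (Fin 3)) + (j : ℝ) •
    Literature.MathematicalPhysics.StatisticalMechanics.triangularVec₂ 2 ∈ V ∧
    Literature.Geometry.DiscreteGeometry.kissingShell V ((i : ℝ) •
    (Literature.MathematicalPhysics.StatisticalMechanics.triangularVec₁ 2 : EuclideanSpace ℝ (Fin
    3)) + (j : ℝ) • Literature.MathematicalPhysics.StatisticalMechanics.triangularVec₂ 2) =
    Literature.Geometry.DiscreteGeometry.layerShell s s :=
  fun _ hV _ hs _ hc _ hpat _ _ h₀c h₀V h₀ => hcp_disc hV hs hc hpat (h₀c.trans (by norm_num)) h₀V h₀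

end Summit.AtomisticToContinuum.Crystallization.Theorems

end
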